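import Summits.BirchSwinnertonDyer.BirchSwinnertonDyer.Theorems.ByReductionTypeAtTwoOrdKatoHalfAtTwoIsoRelaxedGenuineOptimal
import Summits.BirchSwinnertonDyer.BirchSwinnertonDyer.Theorems.ByReductionTypeAtTwoOrdKatoHalfAtTwoIsoPosDiscEpsilon
import Summits.BirchSwinnertonDyer.BirchSwinnertonDyer.Theorems.AlignedTransportAtTwoMainConjectureOfRankZeroBSDAtTwoFineRoadArchRigidity
import Summits.BirchSwinnertonDyer.BirchSwinnertonDyer.Theorems.AlignedTransportAtTwoMainConjectureOfRankZeroBSDAtTwoFineRoadArchReceptacle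
import Literature.NumberTheory.EllipticCurves.IwasawaSelmerRelaxedAtInfinity

/-!
# Cert42 (GEN 42) — crux `OrdKatoHalfAtTwoIso` (stmt-BirchSwinnertonDyer-19573), line `steinberg-fibre-at-two`:
# JOINT SUFFICIENCY OF THE v19 STUB 7-TUPLE **WITHOUT Aʳ** — the crux BY NAME from
# {F1μι⁻, P⁺, Q⁺, bundle, Lim-down ∧ FW, R-opt∃♭, Greenberg L.4.6@2 ∧ Lim-up}, built ONLY from TREE-LANDED modules
# (refuter-grade certificate; nothing asserted, nothing landed; independent of the lead's pending p711951 / p712620 / leaf C)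

Seat `cruxtriage-stmt-BirchSwinnertonDyer-19573-2` (crux-triage round 1, seat 2, GEN 42). PURPOSE: the pen's RC-438 GO #2 replaces the
reserve-tier binder Aʳ (`ArchimedeanLambdaModTwoOrdAtTwo`, `…RelaxedGenuineDefs`) on the not-onto road by the PRINT fact
`Greenberg1999.lemma46_relaxed_mod_selmer_infinite_rat_two` (h46, p608868) + Kato 17.4 (1) at `2` (h17, third conjunct of PUB); the lead's
v19 registers `stub_lemma46_limUp : h46 ∧ Lim@2-upstairs` and `stub_relaxedZetaOptimal_existsMember_flat : R-opt∃♭` in place of v18's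
`stub_colemanHalfClass_optimal_off514`. This file checks, BEFORE v19 is registered and with NO unlanded import, that the seven v19 stub TYPES
(five registered v18 types verbatim + the two announced ones) GIVE THE CRUX BY NAME (§6 `ordKatoHalfAtTwoIso_of_v19_stubs`), i.e. that the
«re-glue of Cert39b §3 on (h46, hD)» is indeed one line and that `hD : D.IsTorsion` is available where the door needs it (from h17 at the
witness member's conductor-level newform — the level at which `X5.O1.KatoMuPartAtTwo` asks). It also records which print conjuncts the road
leaves IDLE (`stub_bundle.2.2` = Greenberg 5.14@2 and `stub_limFW.1` = Lim@2-downstairs are not consumed by THIS composition).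

HONEST FRAMING (cell bsd-2adic): BSD is not proved by any of this; the crux, B7, child 23921 and the pair child 24097 are NOT proved here;
every theorem below is CONDITIONAL on its displayed hypotheses (memo-tier R-opt∃♭ / F1μι⁻ / P⁺, research-tier Q⁺, print-tier facts as
hypotheses). §0 is audit-2's `ArchOfLemma46` evidence (bsd-2adic-audit-2 GEN 64, evidence #6 on 24097; = the lead's pending p712620)
re-typed in this namespace so that the certificate imports only the tree.

* §0 `module_finite_relaxedDual`, `lengthAt_selmer_add_one_le_relaxed_of_lemma46` — audit-2's lemmas (f1-sign2 kernel by name).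
* §1 R-opt∃♭ `RelaxedZetaOptimalAtTwoExistsMemberFlat` — Cert39b §1 VERBATIM (the lead's p711951 §1 = this text modulo the ORDER of the
  two conjuncts after `IsIsogenous W W₁ ∧`, bus 10:16Z; immaterial).
* §2 `katoMuPartAtTwo_of_relaxedColemanNeron_of_kato17` — Cert39b §2 with the relaxed-data hypothesis asked only for TORSION `D`
  (`D.IsTorsion →`) and only at the conductor-level newform, `hD` fed from h17 at the curve itself.
* §3 `relaxedData_of_package_of_lemma46` — Cert39b §3 re-glued on `(h46, hD)`: ONE line changes (`lengthAt_selmer_add_one_le_relaxed_of_lemma46`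
  in place of `hA … ⟩ + lengthAt_add_one_le_of_archExtension`).
* §4 `katoMuPartAtOptimalMember_of_existsMemberFlat_of_lemma46 : Lim-up → FW → R-opt∃♭ → h46 → h17 → B7 UNCUT` + child 23921 BY NAME.
* §6 the crux BY NAME: `ordKatoHalfAtTwoIso_of_existsMember_of_lemma46` (inputs hNeg, hPos, AU, Lim-up, FW, R-opt∃♭, h46, h17) and
  **`ordKatoHalfAtTwoIso_of_v19_stubs`** (inputs = the seven v19 stub types; `0 < Δ` conjunct via the (ε) door; 5.14@2 and Lim-down idle).

References: [GreenbergLNM1716] §4 Lemma 4.6 (p. 105), Remark (pp. 106–107); [Kato2004Asterisque] Thm 12.5, 12.6, 17.4, Prop 17.11, §17.13;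
[Lim2017FineSelmer] Thm 3.5; [FerreroWashington1979]; [AbbesUllmo1996] Thm A; tree p608868 (h46), p706741 (R-opt), Cert39b.md (crux dir).
-/

set_option autoImplicit false
set_option linter.dupNamespace false

noncomputable section

open scoped Classical MatrixGroups ModularForm NumberField
open CongruenceSubgroup WeierstrassCurve Field IsDedekindDomain NumberField
open Literature.NumberTheory.GaloisRepresentations
open Literature.NumberTheory.GaloisCohomology
open Literature.NumberTheory.EllipticCurves Literature.NumberTheory.EllipticCurves.ModularForms
open Literature.NumberTheory.EllipticCurves.Kato2004
  Literature.NumberTheory.EllipticCurves.Kato2004.EulerSystemValues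
open Literature.NumberTheory.EllipticCurves.Rank1Residual
open Literature.NumberTheory.EllipticCurves.Greenberg1999
open Literature.NumberTheory.IwasawaTheory
open Summit.BirchSwinnertonDyer.BirchSwinnertonDyer.Theorems.Rank1ResidualX1Defs
  Summit.BirchSwinnertonDyer.BirchSwinnertonDyer.Rank1Residual
  Summit.BirchSwinnertonDyer.BirchSwinnertonDyer.Rank1Residual.CoreAssembly
open Summit.BirchSwinnertonDyer.Rank1Residual Summit.BirchSwinnertonDyer.Rank1Residual.X5
  Summit.BirchSwinnertonDyer.Rank1Residual.X1.MuLambda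
open Summit.BirchSwinnertonDyer.BirchSwinnertonDyer.Theorems.OrdKatoOptimalAtTwo
  Summit.BirchSwinnertonDyer.BirchSwinnertonDyer.Theorems.OrdKatoIntAtTwo
open Summit.BirchSwinnertonDyer.BirchSwinnertonDyer.Theses.ByReductionTypeAtTwo
open Summit.BirchSwinnertonDyer.BirchSwinnertonDyer.Theorems.AlignedTransportAtTwoFineRoad
open Summit.BirchSwinnertonDyer.BirchSwinnertonDyer.Theorems.SteinbergFibreAtTwo

namespace Summit.BirchSwinnertonDyer.BirchSwinnertonDyer.Cruxes.OrdKatoHalfAtTwoIso.Cert42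

/-! ## §0 audit-2's `ArchOfLemma46` lemmas (evidence #6 on 24097 = pending p712620), re-typed here so that only the TREE is imported -/

/-- **Every relaxed Selmer dual datum is finitely generated over `Λ`** (dual Nakayama; f1-sign2 `ArchReceptacle.module_finite_of_pinned`
applied to the fields of `Dr`). Unconditional. (audit-2, `ArchOfLemma46.module_finite_relaxedDual`.)
[cite: GreenbergLNM1716, §1 p. 60 (after Conj. 1.3)] -/
theorem module_finite_relaxedDual (W : WeierstrassCurve ℚ) [W.IsElliptic] (κ : ZpExtension ℚ 2) {γ : absoluteGaloisGroup ℚ}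
    (hγ : κ.IsTopGenerator γ) (Dr : W.SelmerDualDataRelaxedInf κ γ) :
    Module.Finite (IwasawaAlgebra 2) Dr.X :=
  ArchReceptacle.module_finite_of_pinned W κ hγ Dr.toDual Dr.bijective Dr.toDual_T_smul Dr.toDual_C_smul

/-- **GRANTED h46: `ℓ₍₂₎(X) + 1 ≤ ℓ₍₂₎(X^{rel ∞})`** for a TORSION strict datum `D`, any relaxed datum `Dr` and any compatible `q`
(audit-2, `ArchOfLemma46.lengthAt_selmer_add_one_le_relaxed_of_lemma46`; f1-sign2 `ArchRigidity.lengthAt_selmer_add_one_le_lengthAt_relaxed`).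
[cite: GreenbergLNM1716, §4 Lemma 4.6 (p. 105) and Remark (pp. 106–107)] -/
theorem lengthAt_selmer_add_one_le_relaxed_of_lemma46 (h46 : lemma46_relaxed_mod_selmer_infinite_rat_two)
    (W : WeierstrassCurve ℚ) [W.IsElliptic] [W.IsGloballyMinimal] (κ : ZpExtension ℚ 2) {γ : absoluteGaloisGroup ℚ}
    (hord : IsOrdinaryAt W 2) (hΔ : 0 < W.Δ) (hκ : κ.IsCyclotomic) (hγ : κ.IsTopGenerator γ)
    (D : W.SelmerDualData κ γ) (Dr : W.SelmerDualDataRelaxedInf κ γ) (hD : D.IsTorsion)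
    (q : Dr.X →ₗ[IwasawaAlgebra 2] D.X)
    (hq : ∀ (x : Dr.X) (s : W.selmerInfty κ),
      D.toDual (q x) s = Dr.toDual x (AddSubgroup.inclusion (W.selmerInfty_le_selmerInftyRelaxedInf κ) s)) :
    Module.lengthAt (IwasawaAlgebra 2) D.X ⟨IwasawaAlgebra.augIdealP 2, IwasawaAlgebra.isPrime_augIdealP_holds 2⟩ + 1 ≤
      Module.lengthAt (IwasawaAlgebra 2) Dr.X ⟨IwasawaAlgebra.augIdealP 2, IwasawaAlgebra.isPrime_augIdealP_holds 2⟩ := by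
  haveI := module_finite_relaxedDual W κ hγ Dr
  exact ArchRigidity.lengthAt_selmer_add_one_le_lengthAt_relaxed W Dr.toDual h46 hord hΔ hκ hγ D hD Dr.bijective q hq

/-! ## §1 R-opt∃♭ — Cert39b §1 VERBATIM (DISPLAYED TEXT; nothing asserted) -/

/-- [MEMO tier, OPEN — a reading, nothing asserted] **R-opt∃♭** — see Cert39b.md §1 in the crux directory for the full gloss: for every
non-CM globally minimal `W`, good ordinary at `2`, `ρ̄_{W,2}` NOT onto, an isogenous globally minimal member `W₁` carrying (a) the FLAT
relaxed-at-`∞` Coleman package in NÉRON currency at every newform / cyclotomic datum / `ϖ` / relaxed data, image clause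
`s·(2^{[0<Δ_{W₁}]}·L₀) ∈ M` for every `L₀` with `ι L₀ = ϖ·L₂(f, α_{W₁})`, and (b) clause (b) of B7 verbatim. Memo witness `W₁ := E•`.
NOT in print at `2`; nothing asserted.
[cite: Kato2004Asterisque, Thm. 12.6 (p. 222), Thm. 17.4 (1)(2) (p. 273), Prop. 17.11 (p. 277), §17.13 (pp. 279–280) (shape only; nothing asserted)]
[cite: Wuthrich2014, Prop. 8 and §2.2 (p. 388–389) (shape only)] -/
def RelaxedZetaOptimalAtTwoExistsMemberFlat : Prop :=
  ∀ (W : WeierstrassCurve ℚ) [W.IsElliptic] [W.IsGloballyMinimal],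
    ¬ W.HasCM → GoodOrd W 2 → ¬ W.HasSurjectiveModNGaloisRep 2 →
    ∃ (W₁ : WeierstrassCurve ℚ) (_ : W₁.IsElliptic) (_ : W₁.IsGloballyMinimal),
      WeierstrassCurve.IsIsogenous W W₁ ∧
      (∀ {N : ℕ} [NeZero N] (f : CuspForm (Gamma0 N) 2) (κ : ZpExtension ℚ 2) (γ : absoluteGaloisGroup ℚ),
        κ.IsCyclotomic → κ.IsTopGenerator γ → IsCyclotomicVariable 2 γ → IsNewformOf W₁ f →
        ∀ ϖ : ℚ, (ϖ : ℝ) * W₁.realPeriodRat = plusPeriod f →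
        ∀ (Dr : W₁.SelmerDualDataRelaxedInf κ γ) (Yr : W₁.FineSelmerDualDataRelaxedInf κ γ),
          ∃ (P : Submodule (IwasawaAlgebra 2) (IwasawaAlgebra 2)) (M : Submodule (IwasawaAlgebra 2) P)
            (τ : P →ₛₗ[((IwasawaAlgebra.involEquiv 2).toRingEquiv : IwasawaAlgebra 2 →+* IwasawaAlgebra 2)] Dr.X)
            (π : Dr.X →ₗ[IwasawaAlgebra 2] Yr.X),
            (∀ m ∈ M, τ m = 0) ∧ Function.Surjective π ∧ Function.Exact τ π ∧
            ∀ L₀ : IwasawaAlgebra 2,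
              iwasawaToPowerSeries 2 L₀ =
                  PowerSeries.C (ϖ : ℚ_[2]) * padicLFunction f (unitRoot W₁ 2 : ℚ_[2]) →
                ∃ s : IwasawaAlgebra 2, s ∉ IwasawaAlgebra.augIdealP 2 ∧
                  s * (PowerSeries.C (((2 : ℕ) : ℤ_[2]) ^ (if 0 < W₁.Δ then 1 else 0)) * L₀) ∈
                    Submodule.map P.subtype M) ∧
      ∀ [NeZero (W₁.conductorNorm ℤ)] (f : CuspForm (Gamma0 (W₁.conductorNorm ℤ)) 2),
        IsNewformOf W₁ f → ∀ ϖ : ℚ, (ϖ : ℝ) * W₁.realPeriodRat = plusPeriod f →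
          ∃ L₀ : IwasawaAlgebra 2, iwasawaToPowerSeries 2 L₀ =
            PowerSeries.C (ϖ : ℚ_[2]) * padicLFunction f (unitRoot W₁ 2 : ℚ_[2])

/-! ## §2 The one-curve slack door in NÉRON currency, relaxed data asked for TORSION `D` only (fed by Kato 17.4 (1) at `2`) -/

/-- **`X5.O1.KatoMuPartAtTwo W′` at ONE curve** from (i) relaxed data booked at `2^e·L₀` for every TORSION strict datum `D` at the
conductor-level newform (archimedean clause `ℓ₍₂₎(X) + e ≤ ℓ₍₂₎(Xr)`, image clause for every `L₀` with `ι L₀ = ϖ·L₂(f, α)`),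
(ii) relaxed (A₂) «`ℓ₍₂₎(X₀^{rel}) = 0`», (iii) Kato 17.4 (1)(2) at `2` at `W′` (supplies `D.IsTorsion`). Cert39b §2 otherwise verbatim
(`mu_le_mu_of_relaxedColemanSemilinear_of_arch` at `G := L₀`). [cite: Kato2004Asterisque, Thm. 17.4 (1) (p. 273), §17.13 (pp. 279–280)]
[cite: GreenbergLNM1716, §4 Lemma 4.6 (PDF pp. 106–107)] -/
theorem katoMuPartAtTwo_of_relaxedColemanNeron_of_kato17 (W' : WeierstrassCurve ℚ) [W'.IsElliptic] [W'.IsGloballyMinimal]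
    (hR : ∀ [NeZero (W'.conductorNorm ℤ)] (f : CuspForm (Gamma0 (W'.conductorNorm ℤ)) 2) (κ : ZpExtension ℚ 2)
      (γ : absoluteGaloisGroup ℚ),
      κ.IsCyclotomic → κ.IsTopGenerator γ → IsCyclotomicVariable 2 γ → IsNewformOf W' f →
      ∀ ϖ : ℚ, (ϖ : ℝ) * W'.realPeriodRat = plusPeriod f →
      ∀ (D : W'.SelmerDualData κ γ) (Yr : W'.FineSelmerDualDataRelaxedInf κ γ), D.IsTorsion →
        ∃ (Xr : Type) (_ : AddCommGroup Xr) (_ : Module (IwasawaAlgebra 2) Xr)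
          (θ : IwasawaAlgebra 2 ≃+* IwasawaAlgebra 2) (P : Submodule (IwasawaAlgebra 2) (IwasawaAlgebra 2))
          (M : Submodule (IwasawaAlgebra 2) P)
          (τ : P →ₛₗ[(θ : IwasawaAlgebra 2 →+* IwasawaAlgebra 2)] Xr) (π : Xr →ₗ[IwasawaAlgebra 2] Yr.X) (e : ℕ),
          (∀ m ∈ M, τ m = 0) ∧ Function.Surjective π ∧ Function.Exact τ π ∧
          Module.lengthAt (IwasawaAlgebra 2) D.X
              ⟨IwasawaAlgebra.augIdealP 2, IwasawaAlgebra.isPrime_augIdealP_holds 2⟩ + e ≤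
            Module.lengthAt (IwasawaAlgebra 2) Xr ⟨IwasawaAlgebra.augIdealP 2, IwasawaAlgebra.isPrime_augIdealP_holds 2⟩ ∧
          ∀ L₀ : IwasawaAlgebra 2,
            iwasawaToPowerSeries 2 L₀ = PowerSeries.C (ϖ : ℚ_[2]) * padicLFunction f (unitRoot W' 2 : ℚ_[2]) →
              ∃ s : IwasawaAlgebra 2, s ∉ IwasawaAlgebra.augIdealP 2 ∧
                s * (PowerSeries.C (((2 : ℕ) : ℤ_[2]) ^ e) * L₀) ∈ Submodule.map P.subtype M)
    (hAr : ∀ (κ : ZpExtension ℚ 2) (γ : absoluteGaloisGroup ℚ), κ.IsCyclotomic → κ.IsTopGenerator γ →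
      ∀ Yr : W'.FineSelmerDualDataRelaxedInf κ γ,
        Module.lengthAt (IwasawaAlgebra 2) Yr.X ⟨IwasawaAlgebra.augIdealP 2, IwasawaAlgebra.isPrime_augIdealP_holds 2⟩ = 0)
    (h17W : ∀ [NeZero (W'.conductorNorm ℤ)] (f : CuspForm (Gamma0 (W'.conductorNorm ℤ)) 2),
      kato_divisibility_allPrimes W' 2 (f := f)) :
    O1.KatoMuPartAtTwo W' := by
  intro κ γ hκ hγ hγ' hord _ f hf ϖ hϖf D L₀ hL₀
  have hD : D.IsTorsion := (h17W f κ γ hκ hγ hγ' hord hf D).1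
  obtain ⟨Yr⟩ := W'.nonempty_fineSelmerDualDataRelaxedInf κ hγ
  obtain ⟨Xr, _, _, θ, P, M, τ, π, e, hτM, -, hπ, harch, himg⟩ := hR f κ γ hκ hγ hγ' hf ϖ hϖf D Yr hD
  by_cases hL0 : L₀ = 0
  · rw [hL0]; exact dvd_zero _
  have hμ : D.mu ≤ mu L₀ :=
    mu_le_mu_of_relaxedColemanSemilinear_of_arch (D := D) hL0 θ P M τ π hτM hπ (himg L₀ hL₀) harch (hAr κ γ hκ hγ Yr)
  calc (PowerSeries.C (((2 : ℕ) : ℤ_[2]) ^ D.mu) : IwasawaAlgebra 2)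
      ∣ PowerSeries.C (((2 : ℕ) : ℤ_[2]) ^ mu L₀) := map_dvd _ (pow_dvd_pow _ hμ)
    _ ∣ L₀ := C_pow_mu_dvd hL0

/-! ## §3 Relaxed data at ONE good-ordinary curve from a package with an arbitrary image predicate — RE-GLUED ON (h46, hD) -/

/-- **The relaxed data of the door at ONE good-ordinary curve `V` for a TORSION strict datum `D`, from a package whose image clause is keyed
to an arbitrary predicate `Φ` on `Λ`, plus Greenberg's Lemma 4.6 at `2` (h46, PRINT)** — Cert39b §3 with `hA` (Aʳ) replaced by `(h46, hD)`:
on `0 < Δ_V` the archimedean clause `ℓ₍₂₎(X) + 1 ≤ ℓ₍₂₎(X^{rel})` is §0's `lengthAt_selmer_add_one_le_relaxed_of_lemma46`; on `Δ_V < 0`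
(`e = 0`) it is the surjectivity of `q`. ONE line differs from Cert39b §3. [cite: GreenbergLNM1716, §4 Lemma 4.6 (p. 105) and Remark (pp. 106–107)] -/
theorem relaxedData_of_package_of_lemma46 (h46 : lemma46_relaxed_mod_selmer_infinite_rat_two)
    (V : WeierstrassCurve ℚ) [V.IsElliptic] [V.IsGloballyMinimal] (hord : IsOrdinaryAt V 2)
    (Φ : IwasawaAlgebra 2 → Prop) {κ : ZpExtension ℚ 2} {γ : absoluteGaloisGroup ℚ} (hκ : κ.IsCyclotomic)
    (hγ : κ.IsTopGenerator γ) (D : V.SelmerDualData κ γ) (hD : D.IsTorsion) (Yr : V.FineSelmerDualDataRelaxedInf κ γ)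
    (hpack : ∀ Dr : V.SelmerDualDataRelaxedInf κ γ,
      ∃ (P : Submodule (IwasawaAlgebra 2) (IwasawaAlgebra 2)) (M : Submodule (IwasawaAlgebra 2) P)
        (τ : P →ₛₗ[((IwasawaAlgebra.involEquiv 2).toRingEquiv : IwasawaAlgebra 2 →+* IwasawaAlgebra 2)] Dr.X)
        (π : Dr.X →ₗ[IwasawaAlgebra 2] Yr.X),
        (∀ m ∈ M, τ m = 0) ∧ Function.Surjective π ∧ Function.Exact τ π ∧
        ∀ L₀ : IwasawaAlgebra 2, Φ L₀ →
          ∃ s : IwasawaAlgebra 2, s ∉ IwasawaAlgebra.augIdealP 2 ∧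
            s * (PowerSeries.C (((2 : ℕ) : ℤ_[2]) ^ (if 0 < V.Δ then 1 else 0)) * L₀) ∈ Submodule.map P.subtype M) :
    ∃ (Xr : Type) (_ : AddCommGroup Xr) (_ : Module (IwasawaAlgebra 2) Xr)
      (θ : IwasawaAlgebra 2 ≃+* IwasawaAlgebra 2) (P : Submodule (IwasawaAlgebra 2) (IwasawaAlgebra 2))
      (M : Submodule (IwasawaAlgebra 2) P)
      (τ : P →ₛₗ[(θ : IwasawaAlgebra 2 →+* IwasawaAlgebra 2)] Xr) (π : Xr →ₗ[IwasawaAlgebra 2] Yr.X) (e : ℕ),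
      (∀ m ∈ M, τ m = 0) ∧ Function.Surjective π ∧ Function.Exact τ π ∧
      Module.lengthAt (IwasawaAlgebra 2) D.X
          ⟨IwasawaAlgebra.augIdealP 2, IwasawaAlgebra.isPrime_augIdealP_holds 2⟩ + e ≤
        Module.lengthAt (IwasawaAlgebra 2) Xr ⟨IwasawaAlgebra.augIdealP 2, IwasawaAlgebra.isPrime_augIdealP_holds 2⟩ ∧
      ∀ L₀ : IwasawaAlgebra 2, Φ L₀ →
        ∃ s : IwasawaAlgebra 2, s ∉ IwasawaAlgebra.augIdealP 2 ∧
          s * (PowerSeries.C (((2 : ℕ) : ℤ_[2]) ^ e) * L₀) ∈ Submodule.map P.subtype M := by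
  let Dr : V.SelmerDualDataRelaxedInf κ γ := V.selmerDualDataRelaxedInf κ hγ
  obtain ⟨q, hq⟩ := exists_relaxedSelmerRestrict V κ hγ Dr D
  have hqs := relaxedSelmerRestrict_surjective V κ Dr D q hq
  obtain ⟨P, M, τ, π, hτM, hπs, hπ, himg⟩ := hpack Dr
  refine ⟨Dr.X, inferInstance, inferInstance, (IwasawaAlgebra.involEquiv 2).toRingEquiv, P, M, τ, π,
    (if 0 < V.Δ then 1 else 0), hτM, hπs, hπ, ?_, himg⟩
  by_cases hΔ : 0 < V.Δ
  · rw [if_pos hΔ, Nat.cast_one]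
    exact lengthAt_selmer_add_one_le_relaxed_of_lemma46 h46 V κ hord hΔ hκ hγ D Dr hD q hq
  · rw [if_neg hΔ, Nat.cast_zero, add_zero]
    exact Module.lengthAt_le_of_surjective q hqs _

/-! ## §4 B7 UNCUT and the child 23921 BY NAME from R-opt∃♭ + h46 + h17 + Lim@2 upstairs + Ferrero–Washington -/

/-- **B7 UNCUT `KatoMuPartAtOptimalMemberOfNotSurjectiveTwo` BY NAME ⟸ Lim 2017 Thm 3.5 at `2` UPSTAIRS (print) + Ferrero–Washington
(print) + R-opt∃♭ (memo) + Greenberg L.4.6 at `2` (h46, print) + Kato 17.4 (1)(2) at `2` (h17, print; only (1) = cotorsion is used here).**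
NO Aʳ, NO Abbes–Ullmo, NO modularity, NO Greenberg 5.14@2. Witness member `W₁` and clause (b) from R-opt∃♭; clause (a) at `W₁` = §2 over §3
with relaxed (A₂) at `W₁` (`not_hasSurjectiveModNGaloisRep_two_of_isIsogenous` + Lim-up + FW). CONDITIONAL; nothing closed.
[cite: Lim2017FineSelmer, §3 Thm. 3.5 and Lemma 3.2] [cite: FerreroWashington1979, Theorem] [cite: GreenbergLNM1716, §4 Lemma 4.6 (p. 105)]
[cite: Kato2004Asterisque, Thm. 17.4 (1) (p. 273)] -/
theorem katoMuPartAtOptimalMember_of_existsMemberFlat_of_lemma46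
    (hLim : Lim2017.thm35_at_two_upstairs_fineSelmer_twoTorsion_finite_of_classicalMuVanishes)
    (hFW : ferreroWashington1979_classicalMuVanishes)
    (hR : RelaxedZetaOptimalAtTwoExistsMemberFlat) (h46 : lemma46_relaxed_mod_selmer_infinite_rat_two)
    (h17 : ∀ (V : WeierstrassCurve ℚ) [V.IsElliptic] [V.IsGloballyMinimal] [NeZero (V.conductorNorm ℤ)]
      (f : CuspForm (Gamma0 (V.conductorNorm ℤ)) 2), kato_divisibility_allPrimes V 2 (f := f)) :
    KatoMuPartAtOptimalMemberOfNotSurjectiveTwo := by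
  intro W _ _ hcm hgo hns
  obtain ⟨W₁, _, _, hiso, hpack, hint⟩ := hR W hcm hgo hns
  have hgo₁ : GoodOrd W₁ 2 := goodOrd_two_of_isIsogenous W hiso hgo
  have hns₁ : ¬ W₁.HasSurjectiveModNGaloisRep 2 := not_hasSurjectiveModNGaloisRep_two_of_isIsogenous W hns hiso
  refine ⟨W₁, ‹_›, ‹_›, hiso, ?_, hint⟩
  refine katoMuPartAtTwo_of_relaxedColemanNeron_of_kato17 W₁ (fun f κ γ hκ hγ hγ' hf ϖ hϖ D Yr hD ↦ ?_)
    (fun κ γ hκ hγ Yr ↦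
      lengthAt_fineRelaxed_eq_zero_of_not_hasSurjectiveModNGaloisRep_of_limUpstairs_of_FW hLim hFW W₁ hns₁ hκ hγ Yr)
    (fun f ↦ h17 W₁ f)
  exact relaxedData_of_package_of_lemma46 h46 W₁ ⟨hgo₁.1, hgo₁.2⟩
    (fun L₀ ↦ iwasawaToPowerSeries 2 L₀ = PowerSeries.C (ϖ : ℚ_[2]) * padicLFunction f (unitRoot W₁ 2 : ℚ_[2]))
    hκ hγ D hD Yr (fun Dr ↦ hpack f κ γ hκ hγ hγ' hf ϖ hϖ Dr Yr)

/-- **The route's child `OrdKatoMuPartOptimalAtTwo` (stmt-BirchSwinnertonDyer-23921, text = B7′ verbatim) BY NAME** from the same five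
inputs (B7 ⇒ B7′, `katoMuPartOff514_of_katoMuPartAtOptimalMember`, p679274). CONDITIONAL; the item is NOT closed by this.
[cite: Lim2017FineSelmer, §3 Thm. 3.5] [cite: FerreroWashington1979, Theorem] [cite: GreenbergLNM1716, §4 Lemma 4.6 (p. 105)] -/
theorem ordKatoMuPartOptimalAtTwo_of_existsMemberFlat_of_lemma46
    (hLim : Lim2017.thm35_at_two_upstairs_fineSelmer_twoTorsion_finite_of_classicalMuVanishes)
    (hFW : ferreroWashington1979_classicalMuVanishes)
    (hR : RelaxedZetaOptimalAtTwoExistsMemberFlat) (h46 : lemma46_relaxed_mod_selmer_infinite_rat_two)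
    (h17 : ∀ (V : WeierstrassCurve ℚ) [V.IsElliptic] [V.IsGloballyMinimal] [NeZero (V.conductorNorm ℤ)]
      (f : CuspForm (Gamma0 (V.conductorNorm ℤ)) 2), kato_divisibility_allPrimes V 2 (f := f)) :
    OrdKatoMuPartOptimalAtTwo :=
  katoMuPartOff514_of_katoMuPartAtOptimalMember (katoMuPartAtOptimalMember_of_existsMemberFlat_of_lemma46 hLim hFW hR h46 h17)

/-! ## §6 The crux BY NAME — WITHOUT Aʳ -/

/-- **The crux `OrdKatoHalfAtTwoIso` (stmt-BirchSwinnertonDyer-19573) BY NAME from F1μι⁻ (memo), the direct `0 < Δ` child (by name),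
Abbes–Ullmo, Lim@2 upstairs, Ferrero–Washington, R-opt∃♭, Greenberg L.4.6 at `2` and Kato 17.4 (1)(2) at `2`** —
`ordKatoHalfAtTwoIso_of_iota_halves_B7` with B7 := §4. NO Aʳ, NO Greenberg 5.14@2, NO modularity on the not-onto road. CONDITIONAL; the crux
is NOT closed by this. [cite: Kato2004Asterisque, Thm. 17.4 (1)(2) (p. 273)] [cite: AbbesUllmo1996, Thm. A] [cite: GreenbergLNM1716, §4 Lemma 4.6 (p. 105)] -/
theorem ordKatoHalfAtTwoIso_of_existsMember_of_lemma46 (hNeg : ZetaColemanMuIotaNegDiscAtTwo) (hPos : OrdKatoHalfAtTwoIsoPosDisc)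
    (hAU : abbesUllmo_not_dvd_maninConstant_of_not_dvd_level)
    (hLim : Lim2017.thm35_at_two_upstairs_fineSelmer_twoTorsion_finite_of_classicalMuVanishes)
    (hFW : ferreroWashington1979_classicalMuVanishes)
    (hR : RelaxedZetaOptimalAtTwoExistsMemberFlat) (h46 : lemma46_relaxed_mod_selmer_infinite_rat_two)
    (h17 : ∀ (V : WeierstrassCurve ℚ) [V.IsElliptic] [V.IsGloballyMinimal] [NeZero (V.conductorNorm ℤ)]
      (f : CuspForm (Gamma0 (V.conductorNorm ℤ)) 2), kato_divisibility_allPrimes V 2 (f := f)) :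
    OrdKatoHalfAtTwoIso :=
  ordKatoHalfAtTwoIso_of_iota_halves_B7 hNeg hPos hAU
    (katoMuPartAtOptimalMember_of_existsMemberFlat_of_lemma46 hLim hFW hR h46 h17) h17

/-- **JOINT SUFFICIENCY OF THE v19 STUB 7-TUPLE (types only; no stub NAME of the unregistered skeleton is used)**: the crux BY NAME from
`s1 : ZetaColemanMuIotaNegDiscAtTwo` (F1μι⁻, memo) · `s2 : ColemanMuSpanFreeIotaPosDiscAtTwo` (P⁺, memo) · `s3 : FineSelmerConjATwoOrdPosDisc`
(Q⁺, research) · `s4 : PUB ∧ Abbes–Ullmo ∧ Greenberg 5.14@2` (bundle, print; = child 23889 verbatim) · `s5 : Lim@2-downstairs ∧ Ferrero–Washington`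
(print) · `s6 : R-opt∃♭` (memo-exact 394/394) · `s7 : Greenberg L.4.6@2 ∧ Lim@2-upstairs` (print ×2). Composition: the `0 < Δ` conjunct by the
(ε) door `ordKatoHalfAtTwoIsoPosDisc_of_epsilon s2 s3 AU h17`, B7 UNCUT by §4, the crux by `ordKatoHalfAtTwoIso_of_iota_halves_B7`.
IDLE on this road: `s4.2.2` (Greenberg 5.14@2) and `s5.1` (Lim@2-downstairs) — discarded below (`-`). CONDITIONAL; the crux is NOT closed.
[cite: Kato2004Asterisque, Thm. 17.4 (1)(2) (p. 273)] [cite: AbbesUllmo1996, Thm. A] [cite: GreenbergLNM1716, §4 Lemma 4.6 (p. 105)]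
[cite: Lim2017FineSelmer, §3 Thm. 3.5 and Lemma 3.2] [cite: FerreroWashington1979, Theorem] -/
theorem ordKatoHalfAtTwoIso_of_v19_stubs (s1 : ZetaColemanMuIotaNegDiscAtTwo) (s2 : ColemanMuSpanFreeIotaPosDiscAtTwo)
    (s3 : FineSelmerConjATwoOrdPosDisc)
    (s4 : Literature.Uncategorized.OrdPublishedInputsAtTwo ∧ abbesUllmo_not_dvd_maninConstant_of_not_dvd_level ∧
      Literature.NumberTheory.EllipticCurves.Greenberg1999.prop514_isTorsion_mu_eq_zero_two)
    (s5 : Lim2017.thm35_at_two_fineSelmerDual_moduleFinite_of_classicalMuVanishes_of_le_divisionField_four ∧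
      Literature.NumberTheory.IwasawaTheory.ferreroWashington1979_classicalMuVanishes)
    (s6 : RelaxedZetaOptimalAtTwoExistsMemberFlat)
    (s7 : Greenberg1999.lemma46_relaxed_mod_selmer_infinite_rat_two ∧
      Lim2017.thm35_at_two_upstairs_fineSelmer_twoTorsion_finite_of_classicalMuVanishes) :
    Summit.BirchSwinnertonDyer.BirchSwinnertonDyer.Theses.ByReductionTypeAtTwo.OrdKatoHalfAtTwoIso := by
  obtain ⟨hPub, hAU, -⟩ := s4
  obtain ⟨-, hFW⟩ := s5
  obtain ⟨h46, hLim⟩ := s7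
  have h17 : ∀ (V : WeierstrassCurve ℚ) [V.IsElliptic] [V.IsGloballyMinimal] [NeZero (V.conductorNorm ℤ)]
      (f : CuspForm (Gamma0 (V.conductorNorm ℤ)) 2), kato_divisibility_allPrimes V 2 (f := f) := by
    obtain ⟨_, _, h17, _⟩ := hPub
    exact h17
  exact ordKatoHalfAtTwoIso_of_iota_halves_B7 s1 (ordKatoHalfAtTwoIsoPosDisc_of_epsilon s2 s3 hAU h17) hAU
    (katoMuPartAtOptimalMember_of_existsMemberFlat_of_lemma46 hLim hFW s6 h46 h17) h17

/-- **The PAIR child `OrdKatoFineZetaAtTwoResidue` (stmt-BirchSwinnertonDyer-24097) BY NAME over the same types** (unchanged from v16/v18: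
F1μι⁻, P⁺, Q⁺, Abbes–Ullmo, h17 — the (ε) door; neither R-opt∃♭ nor h46 enters). Sanity that the v19 re-cut does not touch 24097's cone.
[cite: Kato2004Asterisque, Thm. 17.4 (1)(2) (p. 273), §17.13 (pp. 279–280)] -/
theorem pair_of_v19_stubs (s1 : ZetaColemanMuIotaNegDiscAtTwo) (s2 : ColemanMuSpanFreeIotaPosDiscAtTwo)
    (s3 : FineSelmerConjATwoOrdPosDisc)
    (s4 : Literature.Uncategorized.OrdPublishedInputsAtTwo ∧ abbesUllmo_not_dvd_maninConstant_of_not_dvd_level ∧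
      Literature.NumberTheory.EllipticCurves.Greenberg1999.prop514_isTorsion_mu_eq_zero_two) :
    OrdKatoFineZetaAtTwoResidue := by
  obtain ⟨hPub, hAU, -⟩ := s4
  have h17 : ∀ (V : WeierstrassCurve ℚ) [V.IsElliptic] [V.IsGloballyMinimal] [NeZero (V.conductorNorm ℤ)]
      (f : CuspForm (Gamma0 (V.conductorNorm ℤ)) 2), kato_divisibility_allPrimes V 2 (f := f) := by
    obtain ⟨_, _, h17, _⟩ := hPub
    exact h17
  exact ordKatoFineZetaAtTwoResidue_of_negDisc_of_epsilon s1 s2 s3 hAU h17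

end Summit.BirchSwinnertonDyer.BirchSwinnertonDyer.Cruxes.OrdKatoHalfAtTwoIso.Cert42

end
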